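import Summits.CriticalPhenomena.CardyFormulaZ2.Theses.CardyMirrorMonotone
import Summits.CriticalPhenomena.CardyFormulaZ2.Theses.CardyExpCovariance
import Summits.CriticalPhenomena.CardyFormulaZ2.Theses.CardyBlackNoise
import Summits.CriticalPhenomena.CardyFormulaZ2.Theorems.CardyAnchoredRigiditySubseqCardyStubDiagonalCauchy

/-!
# The crux `SubseqRigidity` (stmt-CriticalPhenomena-8271) and its verbatim twins / full-filter cousin
# — strategist r1, 2026-08-17 (dedup evidence: ONE identification conjunct, counted once per summit)

* `iff_cardyRigiditySeq` : `CardyMirrorMonotone.SubseqRigidity ↔ CardyExpCovariance.CardyRigiditySeq`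
  (stmt-8271 ↔ stmt-4680; binder permutation);
* `iff_subseqCardyRigidity` : `CardyMirrorMonotone.SubseqRigidity ↔ CardyBlackNoise.SubseqCardyRigidity`
  (stmt-8271 ↔ stmt-8850; binder permutation);
* `fullFilter_of_subseqRigidity` : stmt-8271 implies the full-filter cousin `CardyRigidity`
  (stmt-CriticalPhenomena-0746, normalised signature `∀ f, (∀ R, R.HasCrossingLimit (bondDomainCrossingProb R) f)
  → EqOn f cardyFunction (Ioo 0 1)`, shared by 9 routes) along the meshes `1/(n+1)`.
-/

noncomputable section

namespace Summit.CriticalPhenomena.CardyFormulaZ2.Cruxes.SubseqRigidity.Strategist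

open Set Filter Topology
open Literature.Probability.RandomPlanarGeometry
open Literature.Probability.Percolation (bondDomainCrossingProb)
open Summit.CriticalPhenomena.CardyFormulaZ2.Theses
open Summit.CriticalPhenomena.CardyFormulaZ2.Cruxes.SubseqCardy.Birth

/-- stmt-8271 ↔ stmt-4680. [folklore] -/
theorem iff_cardyRigiditySeq :
    CardyMirrorMonotone.SubseqRigidity ↔ CardyExpCovariance.CardyRigiditySeq :=
  ⟨fun h u f hu hf ↦ h u hu f hf, fun h u hu g hg ↦ h u g hu hg⟩

/-- stmt-8271 ↔ stmt-8850. [folklore] -/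
theorem iff_subseqCardyRigidity :
    CardyMirrorMonotone.SubseqRigidity ↔ CardyBlackNoise.SubseqCardyRigidity :=
  ⟨fun h δ f hδ hf ↦ h δ hδ f hf, fun h u hu g hg ↦ h u g hu hg⟩

/-- stmt-8271 ⇒ stmt-0746 (the full-filter rigidity crux, normalised signature), along `1/(n+1)`.
[folklore] -/
theorem fullFilter_of_subseqRigidity (h : CardyMirrorMonotone.SubseqRigidity) :
    ∀ f : ℝ → ℝ, (∀ R : ConformalRectangle, R.HasCrossingLimit (bondDomainCrossingProb R) f) →
      EqOn f cardyFunction (Ioo 0 1) := by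
  intro f hf
  have hu : Tendsto (fun n : ℕ => 1 / ((n : ℝ) + 1)) atTop (𝓝[>] (0 : ℝ)) :=
    tendsto_one_div_strictMono_add_one_nhdsWithin_Ioi strictMono_id
  exact h _ hu f fun R φ x hx ↦ (hf R φ x hx).comp hu

end Summit.CriticalPhenomena.CardyFormulaZ2.Cruxes.SubseqRigidity.Strategist

end
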